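import Literature.NumberTheory.LFunctions.DedekindZetaExceptionalPrimes
import Literature.NumberTheory.LFunctions.ClassGroupLFunctionNoExceptionalZeroOddDegree
import Literature.NumberTheory.LFunctions.ClassGroupCharacterTwist
import Literature.NumberTheory.LFunctions.UniformClassGroupPNTInputs
import Literature.NumberTheory.NumberFields.ClassFieldsOfCharactersUniqueness
import Literature.NumberTheory.NumberFields.UnramifiedDiscriminant

/-!
# The exceptional prime ideals of a real class group character are rare (Lemme C for `Cl_K`)

Topic `Literature/NumberTheory/LFunctions`, namespace `Literature.NumberTheory.LFunctions.NumberField`.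
Everything here is PROVED (theorems only; no definitions, no named facts).

Let `K` be a number field of degree `n > 1`, `χ₁` a REAL class group character (`χ₁² = 1`; `χ₁ = 1`,
i.e. `ζ_K`, allowed) and `β₁ = 1 − δ₁` a real zero of `L(s, χ₁)` with `3/4 ≤ β₁ < 1`.  Then the prime
ideals `𝔭` with `χ₁(𝔭) = +1` ("exceptional primes") are rare in `Q^{C₁} < N𝔭 ≤ x`, `δ₁ log x ≤ 1`:

  `Σ_{y < N𝔭 ≤ x} (1 + χ₁(𝔭)) N𝔭^{−β₁} ≤ 12 δ₁ log x`     (`sum_primes_weight_le_of_classGroupLFunction_eq_zero`)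

(`Q = |d_K| n^n`, `y ≥ Q^{C₁(n)}`, any finite set of prime ideals with norms in `(y, x]`; the weight is
written `1 + Re ν_{χ₁}(𝔭)` with the tree's `classGroupCharIdealHom`).  For `K = ℚ(√d)`... rather, for
Dirichlet characters this is Bombieri's Lemme C / Tao–Teräväinen (3.13) (tree:
`SiegelZero.TaoTeravainen2021_eq313_holds`); it is the arithmetic heart of the Deuring–Heilbronn
phenomenon for the family `{L(s, χ)}_{χ ∈ Ĉl_K}` in Bombieri's form (Théorème 14, second assertion: the
weights `Λ(𝔫)(1 + χ₁(𝔫)N𝔫^{−δ₁})/2` are small in mean square on the sifted primes).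

Proof: for `χ₁ = 1` this is `DedekindZetaExceptionalPrimes.lean` for `K` (weight `2`).  For `χ₁ ≠ 1`
the tree's class field theory gives the quadratic class field `E/K` of `χ₁` (unramified, `|d_E| = |d_K|²`,
splitting law `𝔭` splits iff `χ₁(𝔭) = 1`, and `ζ_E = ζ_K L(s, χ₁)`, so `ζ_E(β₁) = 0`); a split `𝔭`
carries exactly two primes `𝔓` of `E`, both of norm `N𝔭`, so the weighted sum over `K` is at most the
plain sum `Σ N𝔓^{−β₁}` over the primes of `E` with norms in `(y, x]` (`sum_weight_le_sum_primes_of_splitting`),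
which `DedekindZetaExceptionalPrimes.lean` for `E` (degree `2n`, `Q_E ≤ Q_K^{n+2}`) bounds by `6 δ₁ log x`.

## References

* E. Bombieri, *Le grand crible dans la théorie analytique des nombres*, Astérisque 18 (1987), §6,
  Lemme C. [Bombieri1987GrandCrible]
* T. Tao, J. Teräväinen, J. London Math. Soc. 106 (2022), Proposition 3.5 (3.13). [TaoTeravainen2021]
* D. A. Cox, *Primes of the form x² + ny²*, 2nd ed. (2013), §5.C Cor. 5.24, §8.A Thm. 8.10 (class fields
  of class group characters, splitting law). [Cox2013]
-/

noncomputable section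

open Real Finset Complex NumberField IsDedekindDomain
open scoped NumberField nonZeroDivisors

namespace Literature.NumberTheory.LFunctions.NumberField

open Literature.NumberTheory.LFunctions Literature.NumberTheory.GaloisRepresentations
  Literature.NumberTheory.NumberFields

/-! ### Transfer of the weighted sum to the quadratic class field -/

section Transfer

variable {K : Type*} [Field K] [NumberField K] {E : Type*} [Field E] [NumberField E] [Algebra K E]
  [IsGalois K E]

/-- Above a split prime `v` of a quadratic extension there are two primes, both of norm `Nv`:
`Σ_{𝔓 ∣ v} N𝔓^{−β} = 2 · Nv^{−β}`. [folklore] -/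
theorem sum_primesOver_rpow_eq_two_mul (h2 : Module.finrank K E = 2) {v : HeightOneSpectrum (𝓞 K)}
    (hv : v ∈ splitPrimes K E) (β : ℝ) :
    ∑ Q ∈ (v.asIdeal.primesOver (𝓞 E)).toFinset, (Ideal.absNorm Q : ℝ) ^ (-β) =
      2 * (Ideal.absNorm v.asIdeal : ℝ) ^ (-β) := by
  have hconst : ∀ Q ∈ (v.asIdeal.primesOver (𝓞 E)).toFinset,
      (Ideal.absNorm Q : ℝ) ^ (-β) = (Ideal.absNorm v.asIdeal : ℝ) ^ (-β) := by
    intro Q hQ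
    rw [absNorm_eq_of_mem_splitPrimes hv (Set.mem_toFinset.mp hQ)]
  rw [Finset.sum_congr rfl hconst, Finset.sum_const, ← Set.ncard_eq_toFinset_card',
    ncard_primesOver_of_mem_splitPrimes hv, h2, nsmul_eq_mul]
  norm_num

/-- **Transfer of the exceptional-prime sum to the class field.**  For a quadratic Galois `E/K` with the
splitting law "`𝔭` splits iff `χ(𝔭) = 1`" of a real class group character `χ`, and a finite set `𝒫` of
prime ideals of `K` with norms in `(y, x]` (`y ≥ 0`):
`Σ_{𝔭 ∈ 𝒫} (1 + Re χ(𝔭)) N𝔭^{−β} ≤ Σ_{𝔓 prime of E, y < N𝔓 ≤ x} N𝔓^{−β}`.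
[cite: Cox2013, §8.A Thm. 8.10] -/
theorem sum_weight_le_sum_primes_of_splitting (h2 : Module.finrank K E = 2)
    (χ : ClassGroup (𝓞 K) →* ℂˣ) (hχ : χ * χ = 1)
    (hsplit : ∀ v : HeightOneSpectrum (𝓞 K), v ∈ splitPrimes K E ↔ classGroupCharPrimeValue χ v = 1)
    (β : ℝ) {y : ℝ} (x : ℝ) (hy : 0 ≤ y) (Ps : Finset (Ideal (𝓞 K)))
    (hPs : ∀ P ∈ Ps, P.IsPrime ∧ y < (Ideal.absNorm P : ℝ) ∧ (Ideal.absNorm P : ℝ) ≤ x) :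
    ∑ P ∈ Ps, (1 + (classGroupCharIdealHom χ P).re) * (Ideal.absNorm P : ℝ) ^ (-β) ≤
      ∑ Q ∈ (finite_primeIdealsLE E x).toFinset.filter (fun Q ↦ y < (Ideal.absNorm Q : ℝ)),
        (Ideal.absNorm Q : ℝ) ^ (-β) := by
  classical
  set QsE := (finite_primeIdealsLE E x).toFinset.filter (fun Q ↦ y < (Ideal.absNorm Q : ℝ)) with hQsE
  set g : Ideal (𝓞 E) → Ideal (𝓞 K) := fun Q ↦ Q.under (𝓞 K) with hg
  set f : Ideal (𝓞 E) → ℝ := fun Q ↦ (Ideal.absNorm Q : ℝ) ^ (-β) with hf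
  have hf0 : ∀ Q, 0 ≤ f Q := fun Q ↦ Real.rpow_nonneg (Nat.cast_nonneg _) _
  have hmemQsE : ∀ {Q : Ideal (𝓞 E)}, Q ∈ QsE ↔
      (Q.IsPrime ∧ Q ≠ ⊥ ∧ (Ideal.absNorm Q : ℝ) ≤ x) ∧ y < (Ideal.absNorm Q : ℝ) := by
    intro Q
    rw [hQsE, Finset.mem_filter, mem_primeIdealsLE_toFinset]
  -- restrict to the primes above `Ps` and split along the fibres of `g`
  set QsP := QsE.filter (fun Q ↦ g Q ∈ Ps) with hQsP
  have hsub : QsP ⊆ QsE := Finset.filter_subset _ _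
  have hmaps : ∀ Q ∈ QsP, g Q ∈ Ps := fun Q hQ ↦ (Finset.mem_filter.mp hQ).2
  have hstep1 : ∑ Q ∈ QsP, f Q ≤ ∑ Q ∈ QsE, f Q :=
    Finset.sum_le_sum_of_subset_of_nonneg hsub fun Q _ _ ↦ hf0 Q
  rw [← Finset.sum_fiberwise_of_maps_to hmaps] at hstep1
  refine le_trans (Finset.sum_le_sum fun P hP ↦ ?_) hstep1
  -- the fibre above `P`
  obtain ⟨hPpr, hPy, hPx⟩ := hPs P hP
  have hPne : P ≠ ⊥ := by
    rintro rfl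
    rw [Ideal.absNorm_bot, Nat.cast_zero] at hPy
    linarith
  obtain ⟨v, hvP⟩ : ∃ v : HeightOneSpectrum (𝓞 K), v.asIdeal = P := ⟨⟨P, hPpr, hPne⟩, rfl⟩
  subst hvP
  have hνP : classGroupCharIdealHom χ v.asIdeal = classGroupCharPrimeValue χ v := by
    rw [classGroupCharIdealHom_apply_of_ne_bot χ hPne, classGroupCharPrimeValue_apply]
  have hinner0 : 0 ≤ ∑ Q ∈ QsP.filter (fun Q ↦ g Q = v.asIdeal), f Q := Finset.sum_nonneg fun Q _ ↦ hf0 Q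
  rcases classGroupChar_apply_eq_one_or_eq_neg_one hχ
      (ClassGroup.mk0 ⟨v.asIdeal, mem_nonZeroDivisors_of_ne_zero v.ne_bot⟩) with h1 | hneg
  · -- `χ(𝔭) = 1`: `𝔭` splits; the two primes above it lie in the fibre
    have hval : classGroupCharPrimeValue χ v = 1 := by rw [classGroupCharPrimeValue_apply]; exact h1
    have hsplitv : v ∈ splitPrimes K E := (hsplit v).mpr hval
    have hre : (classGroupCharIdealHom χ v.asIdeal).re = 1 := by rw [hνP, hval, Complex.one_re]
    rw [hre]
    have hsubset : (v.asIdeal.primesOver (𝓞 E)).toFinset ⊆ QsP.filter (fun Q ↦ g Q = v.asIdeal) := by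
      intro Q hQ
      rw [Set.mem_toFinset] at hQ
      have hQne : Q ≠ ⊥ := Ideal.ne_bot_of_mem_primesOver hPne hQ
      have hNQ : Ideal.absNorm Q = Ideal.absNorm v.asIdeal := absNorm_eq_of_mem_splitPrimes hsplitv hQ
      have hgQ : g Q = v.asIdeal := by rw [hg]; exact hQ.2.over.symm
      rw [Finset.mem_filter, hQsP, Finset.mem_filter, hmemQsE, hNQ, hgQ]
      exact ⟨⟨⟨⟨hQ.1, hQne, hPx⟩, hPy⟩, hP⟩, rfl⟩
    calc (1 + 1) * (Ideal.absNorm v.asIdeal : ℝ) ^ (-β) =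
        ∑ Q ∈ (v.asIdeal.primesOver (𝓞 E)).toFinset, f Q := by
          rw [hf]; simp only
          rw [sum_primesOver_rpow_eq_two_mul h2 hsplitv β]; norm_num
      _ ≤ ∑ Q ∈ QsP.filter (fun Q ↦ g Q = v.asIdeal), f Q :=
          Finset.sum_le_sum_of_subset_of_nonneg hsubset fun Q _ _ ↦ hf0 Q
  · -- `χ(𝔭) = −1`: the weight vanishes
    have hval : classGroupCharPrimeValue χ v = -1 := by rw [classGroupCharPrimeValue_apply]; exact hneg
    have hre : (classGroupCharIdealHom χ v.asIdeal).re = -1 := by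
      rw [hνP, hval]; simp
    rw [hre]
    simpa using hinner0

end Transfer

/-! ### The conductor of the quadratic class field -/

/-- `Q_E ≤ Q_K^{n+2}` for a quadratic extension `E/K` unramified at all finite primes (`|d_E| = |d_K|²`,
`(2n)^{2n} = 4^n n^{2n}`, `4 ≤ Q_K`). [folklore] -/
theorem condQn_le_of_quadratic_unramified {K : Type*} [Field K] [NumberField K] {E : Type*} [Field E]
    [NumberField E] [Algebra K E] (h2 : Module.finrank K E = 2)
    (hunr : ∀ (P : Ideal (𝓞 E)) [P.IsMaximal], Algebra.IsUnramifiedAt (𝓞 K) P)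
    (hK : 1 < Module.finrank ℚ K) :
    ThornerZaman.condQn E ≤ ThornerZaman.condQn K ^ ((Module.finrank ℚ K : ℝ) + 2) := by
  set n : ℕ := Module.finrank ℚ K with hn
  have hdegE : Module.finrank ℚ E = 2 * n := by
    rw [← Module.finrank_mul_finrank ℚ K E, h2, hn, mul_comm]
  have hdiscE : |(discr E : ℝ)| = |(discr K : ℝ)| ^ 2 := by
    have h := natAbs_discr_eq_pow_of_forall_isUnramifiedAt (K := K) hunr
    rw [h2] at h
    have h' : (((discr E).natAbs : ℕ) : ℝ) = (((discr K).natAbs : ℕ) : ℝ) ^ 2 := by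
      rw [h]; push_cast; ring
    rwa [Nat.cast_natAbs, Nat.cast_natAbs, Int.cast_abs, Int.cast_abs] at h'
  set Q : ℝ := ThornerZaman.condQn K with hQ
  have hQ12 : (12 : ℝ) ≤ Q := ThornerZaman.twelve_le_condQn (K := K) hK
  have hQdef : Q = |(discr K : ℝ)| * (n : ℝ) ^ n := by rw [hQ, ThornerZaman.condQn]
  have e1 : (2 * (n : ℝ)) ^ (2 * n) = 4 ^ n * ((n : ℝ) ^ n) ^ 2 := by
    rw [mul_pow, pow_mul, pow_mul' (n : ℝ) 2 n]
    norm_num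
  have hQE : ThornerZaman.condQn E = 4 ^ n * Q ^ 2 := by
    rw [ThornerZaman.condQn, hdegE, hdiscE, hQdef]
    push_cast
    rw [e1]
    ring
  rw [hQE]
  have hQ1 : (1 : ℝ) ≤ Q := by linarith
  have h4 : (4 : ℝ) ^ n ≤ Q ^ (n : ℝ) := by
    rw [Real.rpow_natCast]
    exact pow_le_pow_left₀ (by norm_num) (by linarith) n
  calc (4 : ℝ) ^ n * Q ^ 2 ≤ Q ^ (n : ℝ) * Q ^ 2 := by
        refine mul_le_mul_of_nonneg_right h4 (by positivity)
    _ = Q ^ ((n : ℝ) + 2) := by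
        rw [Real.rpow_add (by linarith), Real.rpow_two]

/-! ### Lemme C for a real class group character -/

/-- **Bombieri's Lemme C for the class group: the exceptional prime ideals are rare.**  For every
`n > 1` there is `C₁ > 0` such that for every number field `K` of degree `n`, every real class group
character `χ₁` (`χ₁² = 1`), every real zero `β₁` of `L(s, χ₁)` with `3/4 ≤ β₁ < 1`, all
`x ≥ y ≥ Q^{C₁}` with `(1 − β₁) log x ≤ 1`, and every finite set `𝒫` of prime ideals of `K` with norms in
`(y, x]`: `Σ_{𝔭 ∈ 𝒫} (1 + Re χ₁(𝔭)) N𝔭^{−β₁} ≤ 12 (1 − β₁) log x`.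
[cite: Bombieri1987GrandCrible, §6 Lemme C] [cite: TaoTeravainen2021, Proposition 3.5 (3.13)] -/
theorem sum_primes_weight_le_of_classGroupLFunction_eq_zero (n : ℕ) (hn : 1 < n) :
    ∃ C₁ : ℝ, 0 < C₁ ∧ ∀ (K : Type) [Field K] [NumberField K], Module.finrank ℚ K = n →
      ∀ χ₁ : ClassGroup (𝓞 K) →* ℂˣ, χ₁ * χ₁ = 1 →
      ∀ β : ℝ, 3 / 4 ≤ β → β < 1 → classGroupLFunction K χ₁ β = 0 →
      ∀ x y : ℝ, ThornerZaman.condQn K ^ C₁ ≤ y → y ≤ x → (1 - β) * Real.log x ≤ 1 →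
      ∀ Ps : Finset (Ideal (𝓞 K)),
        (∀ P ∈ Ps, P.IsPrime ∧ y < (Ideal.absNorm P : ℝ) ∧ (Ideal.absNorm P : ℝ) ≤ x) →
        ∑ P ∈ Ps, (1 + (classGroupCharIdealHom χ₁ P).re) * (Ideal.absNorm P : ℝ) ^ (-β) ≤
          12 * (1 - β) * Real.log x := by
  classical
  obtain ⟨C₁K, hC₁K, hK⟩ := sum_primes_rpow_le_of_dedekindZetaCont_eq_zero n hn
  obtain ⟨C₁E, hC₁E, hE⟩ := sum_primes_rpow_le_of_dedekindZetaCont_eq_zero (2 * n) (by omega)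
  set C₁ : ℝ := max C₁K (((n : ℝ) + 2) * C₁E) with hC₁
  refine ⟨C₁, lt_max_of_lt_left hC₁K, fun K _ _ hKn χ₁ hχ β hβ hβ1 h0 x y hy hyx hδx Ps hPs ↦ ?_⟩
  have hKdeg : 1 < Module.finrank ℚ K := by rw [hKn]; exact hn
  set Q : ℝ := ThornerZaman.condQn K with hQ
  have hQ12 : (12 : ℝ) ≤ Q := ThornerZaman.twelve_le_condQn (K := K) hKdeg
  have hQ1 : (1 : ℝ) ≤ Q := by linarith
  have hy1 : 1 ≤ y := le_trans (Real.one_le_rpow hQ1 (le_trans hC₁K.le (le_max_left _ _))) hy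
  have hy0 : (0 : ℝ) ≤ y := by linarith
  have hlogx : 0 ≤ Real.log x := Real.log_nonneg (by linarith)
  have hδlog : 0 ≤ (1 - β) * Real.log x := mul_nonneg (by linarith) hlogx
  have hβne1 : ((β : ℝ) : ℂ) ≠ 1 := by
    intro h; apply hβ1.ne; exact_mod_cast h
  by_cases hχ1 : χ₁ = 1
  · -- `χ₁ = 1`: `ζ_K(β) = 0`, weight `2`
    subst hχ1
    have hζ : dedekindZetaCont K β = 0 := by rwa [classGroupLFunction_one K hβne1] at h0
    have hyK : ThornerZaman.condQn K ^ C₁K ≤ y :=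
      le_trans (Real.rpow_le_rpow_of_exponent_le hQ1 (le_max_left _ _)) hy
    have hA := hK K hKn β hβ hβ1 hζ x y hyK hyx hδx Ps hPs
    have hw : ∀ P ∈ Ps, (1 + (classGroupCharIdealHom (1 : ClassGroup (𝓞 K) →* ℂˣ) P).re) *
        (Ideal.absNorm P : ℝ) ^ (-β) = 2 * (Ideal.absNorm P : ℝ) ^ (-β) := by
      intro P hP
      obtain ⟨-, hPy, -⟩ := hPs P hP
      have hPne : P ≠ ⊥ := by
        rintro rfl
        rw [Ideal.absNorm_bot, Nat.cast_zero] at hPy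
        linarith
      rw [classGroupCharIdealHom_apply_of_ne_bot _ hPne, MonoidHom.one_apply, Units.val_one,
        Complex.one_re]
      norm_num
    rw [Finset.sum_congr rfl hw, ← Finset.mul_sum]
    linarith
  · -- `χ₁ ≠ 1`: pass to the quadratic class field `E`
    obtain ⟨E, hfd, hgal, χg, hcomm, hinj, hunr, hfrob⟩ := exists_classField_char_frobenius χ₁
    haveI := hfd
    haveI := hgal
    haveI : NumberField E := NumberField.of_module_finite K E
    have h2 : Module.finrank K E = 2 := by
      rw [finrank_eq_card_range_of_classField χ₁ E χg hcomm hinj hfrob, card_range_eq_two_of_real hχ hχ1]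
    have hunrAt : ∀ (P : Ideal (𝓞 E)) [P.IsMaximal], Algebra.IsUnramifiedAt (𝓞 K) P := by
      intro P hP
      have hPne : P ≠ ⊥ := Ring.ne_bot_of_isMaximal_of_not_isField hP (RingOfIntegers.not_isField E)
      set v : HeightOneSpectrum (𝓞 K) := HeightOneSpectrum.under (𝓞 K) ⟨P, hP.isPrime, hPne⟩ with hv
      have hPv : P.LiesOver v.asIdeal := ⟨rfl⟩
      exact (Algebra.isUnramifiedIn_iff_forall_of_isDedekindDomain.mp (hunr v)) P hP hPv
    have hsplit : ∀ v : HeightOneSpectrum (𝓞 K), v ∈ splitPrimes K E ↔ classGroupCharPrimeValue χ₁ v = 1 := by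
      intro v
      rw [mem_splitPrimes_iff_eq_one_of_classField χ₁ E χg hinj hunr hfrob v, classGroupCharPrimeValue_apply,
        Units.val_eq_one]
    have hζE : dedekindZetaCont E β = 0 :=
      dedekindZetaCont_eq_zero_of_classGroupLFunction_eq_zero E h2 hunr χ₁ hχ hχ1 hsplit hβne1 h0
    have hdegE : Module.finrank ℚ E = 2 * n := by
      rw [← Module.finrank_mul_finrank ℚ K E, h2, hKn, mul_comm]
    -- `Q_E^{C₁E} ≤ Q_K^{(n+2) C₁E} ≤ Q_K^{C₁} ≤ y`
    have hQE : ThornerZaman.condQn E ≤ Q ^ ((n : ℝ) + 2) := by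
      have := condQn_le_of_quadratic_unramified (K := K) (E := E) h2 hunrAt hKdeg
      rwa [hKn] at this
    have hQE1 : (12 : ℝ) ≤ ThornerZaman.condQn E :=
      ThornerZaman.twelve_le_condQn (K := E) (by rw [hdegE]; omega)
    have hyE : ThornerZaman.condQn E ^ C₁E ≤ y := by
      calc ThornerZaman.condQn E ^ C₁E ≤ (Q ^ ((n : ℝ) + 2)) ^ C₁E :=
            Real.rpow_le_rpow (by linarith) hQE hC₁E.le
        _ = Q ^ (((n : ℝ) + 2) * C₁E) := by rw [← Real.rpow_mul (by linarith)]
        _ ≤ Q ^ C₁ := Real.rpow_le_rpow_of_exponent_le hQ1 (le_max_right _ _)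
        _ ≤ y := hy
    -- the primes of `E` with norms in `(y, x]`
    set QsE := (finite_primeIdealsLE E x).toFinset.filter (fun Q ↦ y < (Ideal.absNorm Q : ℝ)) with hQsE
    have hQs : ∀ P ∈ QsE, P.IsPrime ∧ y < (Ideal.absNorm P : ℝ) ∧ (Ideal.absNorm P : ℝ) ≤ x := by
      intro P hP
      rw [hQsE, Finset.mem_filter, mem_primeIdealsLE_toFinset] at hP
      exact ⟨hP.1.1, hP.2, hP.1.2.2⟩
    have hB := hE E hdegE β hβ hβ1 hζE x y hyE hyx hδx QsE hQs
    have htr := sum_weight_le_sum_primes_of_splitting (K := K) (E := E) h2 χ₁ hχ hsplit β x hy0 Ps hPs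
    linarith

end Literature.NumberTheory.LFunctions.NumberField

end
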